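import Mathlib
import HarnessLib
import Literature.Analysis.ValidatedNumerics.IntervalLogArctan
import Summits.KontsevichZagierPeriods.Zeta5Search.TwoTaleL25GrowthLimit
import Summits.KontsevichZagierPeriods.Zeta5Search.Denom.TwoTaleP15LineCertificate

/-!
# TwoTaleL25GrowthEnclosure — the numerical input `C₁* ≤ 102.84495` at RUNG L(2/5) is DISCHARGED (kernel interval arithmetic)

HONEST FRAMING: systematic search; no irrationality claim unless certified.  Cell pub-zeta5 (measure-opt g0), the L(2/5) port of
P1's `TwoTaleD1GrowthEnclosure` (file T8 of the D1 programme).  `TwoTaleL25Growth` / `TwoTaleL25GrowthLimit` prove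
`log (qhatL25 n) / n → C₁starL25 := rateΛL25 ustarL25`, where `ustarL25` is SOME zero of `slopeGL25` in `[48, 55]` chosen by
the intermediate value theorem.  This file PROVES the enclosure `C₁starL25 ≤ 102.84495` (design value `102.84494056`)
without locating `ustarL25` exactly, with the tree's kernel interval engine `Literature.Analysis.ValidatedNumerics`
(`MI.logPos`, scale `sc = 2^56` and term count `KL` of `Denom/TwoTaleP15LineCertificate`):
* `C₁starL25_le_tangent` — the SUPPORTING-LINE inequality `C₁starL25 ≤ rateΛL25 u + ustarL25·slopeGL25 u` for every
  `u ∈ (79/2, 59)`;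
* `slopeGL25_antitone` — all six logarithmic terms of `slopeGL25` are antitone on the window, hence
  `ustarL25_le_of_neg : slopeGL25 u₁ < 0 → ustarL25 ≤ u₁` (`u₁ > 79/2`);
* numerics ONLY at the rational abscissae `u₀ = 5429/100` and `u₁ = 543/10` (`u* = 54.29091…` lies between):
  the sixteen slope fractions are exact rationals, their logarithms are enclosed by `MI.logPos`, and ONE Boolean test
  `encCheckL25` (`decide +kernel`) certifies `0 ≤ slopeGL25 u₀`, `slopeGL25 u₁ < 0` and
  `rateΛL25 u₀ + u₁·slopeGL25 u₀ ≤ 102.84495`; whence **`C₁starL25_le : C₁starL25 ≤ 102.84495`** (and `≤ 102.845`),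
  since `C₁* ≤ Λ(u₀) + u*·G(u₀) ≤ Λ(u₀) + u₁·G(u₀)` (`G(u₀) ≥ 0`, `u* ≤ u₁`).
Design numerics (`HOME/pub-zeta5-measure-opt/g0/design/l25_growth.py`): `Λ(u₀) = 102.819862`, `G(u₀) = 4.62·10⁻⁴`,
`G(u₁) = −4.63·10⁻³`, bound `102.8449450`, true `C₁ = 102.8449406`.  Nothing here certifies a measure; no irrationality content.
-/

noncomputable section

open Filter Topology Finset Real

namespace Summit.KontsevichZagierPeriods.Zeta5Search.TwoTaleL25Growth

open Summit.KontsevichZagierPeriods.Zeta5Search.TwoTaleP15Growth (tendsto_log_linear_div)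
open Summit.KontsevichZagierPeriods.Zeta5Search.Denom.TwoTaleP15LineCertificate (sc sc_pos KL mem_zero)
open Literature.Analysis.ValidatedNumerics.NumericsMP

/-! ### (a) The supporting-line inequality -/

/-- **Supporting line:** for every `u` in the window, `C₁* ≤ Λ(u) + ustarL25·G(u)` — the Chernoff tangent plane at
slopes `σᵢ(u)` lies above the max-term entropy, in particular above its value `C₁*` at the critical abscissa. -/
theorem C₁starL25_le_tangent {u : ℝ} (hu : 79 / 2 < u) (hu' : u < 59) :
    C₁starL25 ≤ rateΛL25 u + ustarL25 * slopeGL25 u := by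
  have hA : Tendsto (fun n : ℕ => (constKL25 ustarL25 - penPL25 - 8) / (n : ℝ)) atTop (𝓝 0) :=
    tendsto_const_div_atTop_nhds_zero_nat _
  have hB : Tendsto (fun n : ℕ => Real.log (75 * n + 0) / (n : ℝ)) atTop (𝓝 0) :=
    tendsto_log_linear_div (by norm_num) le_rfl
  have hlo : Tendsto (fun n : ℕ => C₁starL25 + ((constKL25 ustarL25 - penPL25 - 8) / (n : ℝ) - 2 * (Real.log (75 * n + 0) / n)))
      atTop (𝓝 C₁starL25) := by
    simpa using tendsto_const_nhds.add (hA.sub (hB.const_mul 2))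
  have hhi : Tendsto (fun n : ℕ => (rateΛL25 u + ustarL25 * slopeGL25 u) + (|slopeGL25 u| + constKL25 u) / (n : ℝ)) atTop
      (𝓝 (rateΛL25 u + ustarL25 * slopeGL25 u)) := by
    simpa using tendsto_const_nhds.add (tendsto_const_div_atTop_nhds_zero_nat (|slopeGL25 u| + constKL25 u))
  refine le_of_tendsto_of_tendsto hlo hhi ?_
  filter_upwards [eventually_ge_atTop 1] with n hn
  have hnpos : (0:ℝ) < n := by exact_mod_cast hn
  have h1 := exp_le_termL25_kcrit hn
  have hk : 37 * n + 1 ≤ kcritL25 n := by have := (kcritL25_range hn).1; omega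
  have h2 := termL25_le_exp n (kcritL25 n) hk hu hu'
  have h12 := Real.exp_le_exp.mp (h1.trans h2)
  obtain ⟨hx0, hx1⟩ := kcritL25_real n
  have hkG : (kcritL25 n : ℝ) * slopeGL25 u ≤ ustarL25 * n * slopeGL25 u + |slopeGL25 u| := by
    have hd : |((kcritL25 n : ℝ) - ustarL25 * n)| ≤ 1 := by rw [abs_le]; constructor <;> linarith
    have h3 : |((kcritL25 n : ℝ) - ustarL25 * n) * slopeGL25 u| ≤ |slopeGL25 u| := by
      rw [abs_mul]; exact mul_le_of_le_one_left (abs_nonneg _) hd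
    have h4 := (abs_le.mp h3).2
    linarith
  rw [add_zero]
  have e1 : C₁starL25 + ((constKL25 ustarL25 - penPL25 - 8) / (n : ℝ) - 2 * (Real.log (75 * n) / n)) =
      (n * C₁starL25 + constKL25 ustarL25 - penPL25 - 2 * Real.log (75 * n) - 8) / n := by
    field_simp; ring
  have e2 : rateΛL25 u + ustarL25 * slopeGL25 u + (|slopeGL25 u| + constKL25 u) / (n : ℝ) =
      (n * rateΛL25 u + ustarL25 * n * slopeGL25 u + |slopeGL25 u| + constKL25 u) / n := by
    field_simp; ring
  rw [e1, e2]
  exact div_le_div_of_nonneg_right (by linarith) hnpos.le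

/-! ### (b) `slopeGL25` is antitone on the window; one-sided location of `ustarL25` -/

/-- All six logarithmic terms of `slopeGL25` are antitone on `(79/2, 59)`, hence so is `slopeGL25`. -/
theorem slopeGL25_antitone {s t : ℝ} (hs : 79 / 2 < s) (hst : s ≤ t) (ht : t < 59) : slopeGL25 t ≤ slopeGL25 s := by
  obtain ⟨⟨a0, b0⟩, ⟨a1, b1⟩, ⟨a2, b2⟩, ⟨a3, b3⟩⟩ := slopes_mem hs (lt_of_le_of_lt hst ht)
  obtain ⟨⟨c0, d0⟩, ⟨c1, d1⟩, ⟨c2, d2⟩, ⟨c3, d3⟩⟩ := slopes_mem (lt_of_lt_of_le hs hst) ht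
  have hs22 : (0:ℝ) < 2 * s - 37 := by linarith
  have hs9 : (0:ℝ) < s - 15 := by linarith
  have m0 : σ₀ t ≤ σ₀ s := by
    unfold σ₀; exact div_le_div_of_nonneg_left (by norm_num) hs22 (by linarith)
  have m1 : σ₁ t ≤ σ₁ s := by
    unfold σ₁; exact div_le_div_of_nonneg_left (by norm_num) hs9 (by linarith)
  have m2 : σ₂ s ≤ σ₂ t := by unfold σ₂; linarith
  have m3 : σ₃ s ≤ σ₃ t := by unfold σ₃; linarith
  have T1 : Real.log (1 - σ₀ s) ≤ Real.log (1 - σ₀ t) := Real.log_le_log (by linarith) (by linarith)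
  have T2 : Real.log (1 - σ₁ s) ≤ Real.log (1 - σ₁ t) := Real.log_le_log (by linarith) (by linarith)
  have T3 : Real.log (σ₂ s) ≤ Real.log (σ₂ t) := Real.log_le_log a2 m2
  have T4 : Real.log (1 - σ₂ t) ≤ Real.log (1 - σ₂ s) := Real.log_le_log (by linarith) (by linarith)
  have T5 : Real.log (σ₃ s) ≤ Real.log (σ₃ t) := Real.log_le_log a3 m3
  have T6 : Real.log (1 - σ₃ t) ≤ Real.log (1 - σ₃ s) := Real.log_le_log (by linarith) (by linarith)
  unfold slopeGL25
  linarith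

/-- If `slopeGL25 u₁ < 0` at some window point `u₁`, then `ustarL25 ≤ u₁`. -/
theorem ustarL25_le_of_neg {u₁ : ℝ} (h1 : 79 / 2 < u₁) (hneg : slopeGL25 u₁ < 0) : ustarL25 ≤ u₁ := by
  by_contra h
  have h' : u₁ < ustarL25 := lt_of_not_ge h
  have hanti := slopeGL25_antitone h1 h'.le ustarL25_bounds.2
  rw [ustarL25_spec.2] at hanti
  linarith

/-! ### (c) Kernel interval enclosures of signed sums of logarithms of rationals -/

/-- Enclosure of `log (p/q)` (`p, q` positive naturals) by the tree's interval logarithm. -/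
def logFrac (p q : ℕ) : Option MI :=
  if q = 0 then none else MI.logPos sc KL (MI.ofFrac sc (p : ℤ) q)

/-- Soundness of `logFrac`. -/
theorem mem_logFrac {p q : ℕ} {L : MI} (h : logFrac p q = some L) :
    MI.mem sc (Real.log ((p : ℝ) / (q : ℝ))) L := by
  unfold logFrac at h
  split_ifs at h with hq
  have hq' : 0 < q := Nat.pos_of_ne_zero hq
  have hx : MI.mem sc (((p : ℤ) : ℝ) / (q : ℝ)) (MI.ofFrac sc (p : ℤ) q) := MI.mem_ofFrac sc (p : ℤ) hq'
  push_cast at hx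
  exact (MI.mem_logPos sc_pos h hx).2

/-- Signed sum `Σ c·log(p/q)` of a list of triples `(c, p, q)`, enclosed. -/
def sumLogs : List (ℤ × ℕ × ℕ) → Option MI
  | [] => some ⟨0, 0⟩
  | (c, p, q) :: l =>
    match logFrac p q, sumLogs l with
    | some L, some T => some (T.add (L.mulInt c))
    | _, _ => none

/-- The real signed sum `Σ c·log(p/q)` of a list of triples `(c, p, q)`. -/
def realSumLogs : List (ℤ × ℕ × ℕ) → ℝ
  | [] => 0
  | (c, p, q) :: l => realSumLogs l + Real.log ((p : ℝ) / (q : ℝ)) * c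

/-- Soundness of `sumLogs`. -/
theorem mem_sumLogs : ∀ (l : List (ℤ × ℕ × ℕ)) {T : MI}, sumLogs l = some T → MI.mem sc (realSumLogs l) T
  | [], T, h => by
    simp only [sumLogs, Option.some.injEq] at h
    subst h
    exact mem_zero
  | (c, p, q) :: l, T, h => by
    simp only [sumLogs] at h
    split at h
    · rename_i L T' hL hT'
      simp only [Option.some.injEq] at h
      subst h
      exact MI.mem_add (mem_sumLogs l hT') (MI.mem_mulInt (mem_logFrac hL) c)
    · simp at h

/-- The eight terms of `rateΛL25 (5429/100)`: slopes `σ₀ = 700/1193`, `σ₁ = 1200/3929`, `σ₂ = 743/900`,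
`σ₃ = 1729/2700` and their complements. -/
def lamList0 : List (ℤ × ℕ × ℕ) :=
  [(-42, 700, 1193), (79, 493, 1193), (-12, 1200, 3929), (27, 2729, 3929),
   (32, 743, 900), (-59, 157, 900), (37, 1729, 2700), (-64, 971, 2700)]

/-- The six terms of `slopeGL25 (5429/100)`. -/
def gList0 : List (ℤ × ℕ × ℕ) :=
  [(-2, 493, 1193), (-1, 2729, 3929), (-1, 743, 900), (1, 157, 900), (-1, 1729, 2700),
   (1, 971, 2700)]

/-- The six terms of `slopeGL25 (543/10)`: slopes `σ₀ = 105/179`, `σ₁ = 40/131`, `σ₂ = 223/270`,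
`σ₃ = 173/270` and their complements. -/
def gList1 : List (ℤ × ℕ × ℕ) :=
  [(-2, 74, 179), (-1, 91, 131), (-1, 223, 270), (1, 47, 270), (-1, 173, 270), (1, 97, 270)]

/-- `rateΛL25 (5429/100)` is the signed sum over `lamList0`. -/
theorem rateΛL25_u0 : rateΛL25 (5429 / 100) = realSumLogs lamList0 := by
  simp only [realSumLogs, lamList0]
  unfold rateΛL25 σ₀ σ₁ σ₂ σ₃
  push_cast
  norm_num
  ring

/-- `slopeGL25 (5429/100)` is the signed sum over `gList0`. -/
theorem slopeGL25_u0 : slopeGL25 (5429 / 100) = realSumLogs gList0 := by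
  simp only [realSumLogs, gList0]
  unfold slopeGL25 σ₀ σ₁ σ₂ σ₃
  push_cast
  norm_num
  ring

/-- `slopeGL25 (543/10)` is the signed sum over `gList1`. -/
theorem slopeGL25_u1 : slopeGL25 (543 / 10) = realSumLogs gList1 := by
  simp only [realSumLogs, gList1]
  unfold slopeGL25 σ₀ σ₁ σ₂ σ₃
  push_cast
  norm_num
  ring

/-- The kernel test: `G(u₀) ≥ 0`, `G(u₁) < 0`, `10⁵·(Λ(u₀) + u₁·G(u₀)) ≤ 10284495` (scaled by `sc`). -/
def encCheckL25 : Bool :=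
  match sumLogs lamList0, sumLogs gList0, sumLogs gList1 with
  | some L, some G0, some G1 =>
    decide (0 ≤ G0.lo) && (decide (G1.hi < 0) && decide (100000 * L.hi + 5430000 * G0.hi ≤ 10284495 * (sc : ℤ)))
  | _, _, _ => false

/-- The kernel test passes. -/
theorem encCheckL25_eq : encCheckL25 = true := by
  decide +kernel

/-- Soundness of the kernel test. -/
theorem encCheckL25_sound (h : encCheckL25 = true) :
    0 ≤ slopeGL25 (5429 / 100) ∧ slopeGL25 (543 / 10) < 0 ∧
      rateΛL25 (5429 / 100) + 543 / 10 * slopeGL25 (5429 / 100) ≤ 102.84495 := by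
  unfold encCheckL25 at h
  split at h
  · rename_i L G0 G1 hL hG0 hG1
    simp only [Bool.and_eq_true, decide_eq_true_eq] at h
    obtain ⟨i1, i2, i3⟩ := h
    have hS : (0 : ℝ) < sc := by exact_mod_cast sc_pos
    have mL := mem_sumLogs lamList0 hL
    have mG0 := mem_sumLogs gList0 hG0
    have mG1 := mem_sumLogs gList1 hG1
    rw [← rateΛL25_u0] at mL
    rw [← slopeGL25_u0] at mG0
    rw [← slopeGL25_u1] at mG1
    unfold MI.mem at mL mG0 mG1
    have c1 : (0 : ℝ) ≤ G0.lo := by exact_mod_cast i1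
    have c2 : (G1.hi : ℝ) < 0 := by exact_mod_cast i2
    have c3 : (100000 : ℝ) * L.hi + 5430000 * G0.hi ≤ 10284495 * (sc : ℝ) := by exact_mod_cast i3
    refine ⟨?_, ?_, ?_⟩
    · have key : 0 ≤ slopeGL25 (5429 / 100) * sc := by linarith [mG0.1]
      nlinarith
    · have key : slopeGL25 (543 / 10) * sc < 0 := by linarith [mG1.2]
      nlinarith
    · have key : (rateΛL25 (5429 / 100) + 543 / 10 * slopeGL25 (5429 / 100)) * sc ≤ (102.84495 : ℝ) * sc := by
        nlinarith [mL.2, mG0.2]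
      exact le_of_mul_le_mul_right key hS
  · simp at h

/-! ### (d) The enclosure -/

/-- **`C₁* ≤ 102.84495`** (design `102.84494056`): supporting line at `u₀ = 5429/100` with `G(u₀) ≥ 0` and
`u* ≤ u₁ = 543/10`. -/
theorem C₁starL25_le : C₁starL25 ≤ 102.84495 := by
  obtain ⟨hG0, hG1, hB⟩ := encCheckL25_sound encCheckL25_eq
  have hu1 : ustarL25 ≤ 543 / 10 := ustarL25_le_of_neg (by norm_num) hG1
  have hT := C₁starL25_le_tangent (u := 5429 / 100) (by norm_num) (by norm_num)
  have hmono : ustarL25 * slopeGL25 (5429 / 100) ≤ 543 / 10 * slopeGL25 (5429 / 100) :=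
    mul_le_mul_of_nonneg_right hu1 hG0
  linarith

/-- `C₁* ≤ 102.845` — a rounded form for quoting. -/
theorem C₁starL25_le' : C₁starL25 ≤ 102.845 := C₁starL25_le.trans (by norm_num)

end Summit.KontsevichZagierPeriods.Zeta5Search.TwoTaleL25Growth

end
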